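import Summits.CriticalPhenomena.PercolationContinuityZ3.Theorems.PercNearOneGluingNoHeavyLowerTailIncStarBranchLemmaStep
import Literature.Probability.Percolation.BergKahnLogSupermodular
import HarnessLib

/-!
# The two-target functional `Ψ` of the apex-forest calculus ((I2′)-tree), I: the same-branch bridge step

Support file for the Sahi programme (`--supports stmt-CriticalPhenomena-4575`, prover prim-sahi-p2 gen 19).  No definitions, no named
facts, no sorries; standard axioms.  Memo `FROM-prim-nh-lead-4575-g120-STAR-HALF.md` §8 (lead g120, THEOREM (I2′)-tree), `prim-sahi-p2/PROOF-E3.md`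
(29d′), (29f).  Root-connection form (`P = prodBernoulli w`, root `s`, port `v`, targets `b, c`; plain `openConn` events): `A = P(v↛s)`,
`D_t = P(t↔v ∧ v↛s)`, `D_bc = P(b↔v ∧ c↔v ∧ v↛s)`, `Ξ_b = P(b↔v ∧ v↛s ∧ s↔c)`, `H_t = P(v↛s ∧ t↮v ∧ s↔t)`, `Z_t = P(t↔v ∨ s↔t)`,
`Cov_t = D_t + H_t − A·Z_t`, **`Ψ(w; v; b, c) = A(Ξ_b + Ξ_c + D_bc) − D_bD_c + D_b·Cov_c + D_c·Cov_b`** — at a port without root pair this IS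
the lead's (I2′) expression (exact check, gen19 `psi_check.py`), and `Ψ ≥ 0` on apex-forests is THEOREM (I2′)-tree (the input of FC's root
pairs and of C½'s R-side lemma).  **`psi_bridge_step_sameBranch`**: if `b, c, x₁` lie in the near side `L ∌ s` of the environment bridge
`e₁ = s(x₁, v)` (`v ∉ L`, no other positive pair leaves `L` except to `s`), then `Ψ(w[e₁↦0]; x₁; b, c) ≥ 0 ⟹ Ψ(w; v; b, c) ≥ 0`, via the
identity `Ψ(w; v) = A′²p·[p·Ψ(w[e₁↦0]; x₁) + (1−p)(S₁ − 2p(1−A₁)D₁bD₁c)]` (`psi_sameBranch_real`, = R1∘R2 of the lead, by `ring`) and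
van den Berg–Kahn 1.1 at `x₁` (`D₁bD₁c ≤ A₁D₁bc`, the lead's (PA)); event layer as in `…IncStarBranchLemmaStep` (Theorem B's machinery).
Remaining for (I2′)-tree: the cases `b = v`, `b = c`, `b` outside `v`'s tree, `b, c` in different branches (two uses of `IncStar.branchLemma`),
and the induction — PROOF-E3 (29f).
-/

noncomputable section
namespace Summit.CriticalPhenomena.PercolationContinuityZ3.Theorems

namespace IncStar

open MeasureTheory Set Literature.Probability.Percolation Literature.Probability.LatticeModels EdgeInduction
open scoped Classical

variable {n : ℕ}

/-- **The arithmetic of the same-branch bridge step for `Ψ`.**  With the big-instance moments written in terms of the pinned sub-instance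
(`A = (1−p)A′ + pA₁A′`, `D_b = pD₁bA′`, …, `Z_b = (1−p)m_b + p(m_b + D₁b)`):
`Ψ = A′²p·[p·Ψ₁ + (1−p)(S₁ − 2p(1−A₁)D₁bD₁c)] ≥ 0` from `Ψ₁ ≥ 0` (induction) and `D₁bD₁c ≤ D₁bc·A₁` (van den Berg–Kahn). [this work] -/
theorem psi_sameBranch_real (p A' A₁ Db Dc Dbc Xb Xc Hb Hc mb mc : ℝ) (hp0 : 0 ≤ p) (hp1 : p ≤ 1)
    (hA₁ : 0 ≤ A₁) (hA₁1 : A₁ ≤ 1) (hDbc : 0 ≤ Dbc) (hXb : 0 ≤ Xb) (hXc : 0 ≤ Xc) (PA : Db * Dc ≤ Dbc * A₁)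
    (IH : 0 ≤ A₁ * (Xb + Xc + Dbc) - Db * Dc + Db * (Dc + Hc - A₁ * (mc + Dc)) + Dc * (Db + Hb - A₁ * (mb + Db))) :
    0 ≤ ((1 - p) * A' + p * (A₁ * A')) * (((1 - p) * 0 + p * (Xb * A')) + ((1 - p) * 0 + p * (Xc * A'))
          + ((1 - p) * 0 + p * (Dbc * A')))
      - ((1 - p) * 0 + p * (Db * A')) * ((1 - p) * 0 + p * (Dc * A'))
      + ((1 - p) * 0 + p * (Db * A'))
        * (((1 - p) * 0 + p * (Dc * A')) + ((1 - p) * (mc * A') + p * (Hc * A'))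
          - ((1 - p) * A' + p * (A₁ * A')) * ((1 - p) * mc + p * (mc + Dc)))
      + ((1 - p) * 0 + p * (Dc * A'))
        * (((1 - p) * 0 + p * (Db * A')) + ((1 - p) * (mb * A') + p * (Hb * A'))
          - ((1 - p) * A' + p * (A₁ * A')) * ((1 - p) * mb + p * (mb + Db))) := by
  have key : ((1 - p) * A' + p * (A₁ * A')) * (((1 - p) * 0 + p * (Xb * A')) + ((1 - p) * 0 + p * (Xc * A'))
          + ((1 - p) * 0 + p * (Dbc * A')))
      - ((1 - p) * 0 + p * (Db * A')) * ((1 - p) * 0 + p * (Dc * A'))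
      + ((1 - p) * 0 + p * (Db * A'))
        * (((1 - p) * 0 + p * (Dc * A')) + ((1 - p) * (mc * A') + p * (Hc * A'))
          - ((1 - p) * A' + p * (A₁ * A')) * ((1 - p) * mc + p * (mc + Dc)))
      + ((1 - p) * 0 + p * (Dc * A'))
        * (((1 - p) * 0 + p * (Db * A')) + ((1 - p) * (mb * A') + p * (Hb * A'))
          - ((1 - p) * A' + p * (A₁ * A')) * ((1 - p) * mb + p * (mb + Db)))
      = A' ^ 2 * p * (p * (A₁ * (Xb + Xc + Dbc) - Db * Dc + Db * (Dc + Hc - A₁ * (mc + Dc)) + Dc * (Db + Hb - A₁ * (mb + Db)))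
          + (1 - p) * ((Xb + Xc + Dbc) - 2 * p * (1 - A₁) * (Db * Dc))) := by ring
  rw [key]
  have h1 : 2 * p * (1 - A₁) * (Db * Dc) ≤ Dbc := by
    have hc0 : 0 ≤ 2 * p * (1 - A₁) := mul_nonneg (mul_nonneg (by norm_num) hp0) (by linarith)
    have h2 : 2 * p * (1 - A₁) * (Db * Dc) ≤ 2 * p * (1 - A₁) * (Dbc * A₁) := mul_le_mul_of_nonneg_left PA hc0
    have hq0 : 0 ≤ 2 * A₁ * (1 - A₁) := by nlinarith
    have h4 : 2 * A₁ * (1 - A₁) ≤ 1 := by nlinarith [sq_nonneg (2 * A₁ - 1)]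
    have h5 : p * (2 * A₁ * (1 - A₁)) ≤ 1 := by nlinarith
    calc 2 * p * (1 - A₁) * (Db * Dc) ≤ 2 * p * (1 - A₁) * (Dbc * A₁) := h2
      _ = Dbc * (p * (2 * A₁ * (1 - A₁))) := by ring
      _ ≤ Dbc * 1 := mul_le_mul_of_nonneg_left h5 hDbc
      _ = Dbc := mul_one _
  have h6 : 0 ≤ (Xb + Xc + Dbc) - 2 * p * (1 - A₁) * (Db * Dc) := by linarith
  have h7 : 0 ≤ p * (A₁ * (Xb + Xc + Dbc) - Db * Dc + Db * (Dc + Hc - A₁ * (mc + Dc)) + Dc * (Db + Hb - A₁ * (mb + Db))) :=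
    mul_nonneg hp0 IH
  have h8 : 0 ≤ (1 - p) * ((Xb + Xc + Dbc) - 2 * p * (1 - A₁) * (Db * Dc)) := mul_nonneg (by linarith) h6
  exact mul_nonneg (mul_nonneg (sq_nonneg A') hp0) (add_nonneg h7 h8)

set_option maxHeartbeats 400000 in
/-- **`Ψ`, the same-branch bridge step** (R1∘R2 of the lead's (I2′)-tree recursion, root-connection form). [this work] -/
theorem psi_bridge_step_sameBranch (w : Sym2 (Fin n) → unitInterval) (L : Set (Fin n)) {s x₁ v b c : Fin n}
    (hsL : s ∉ L) (hxL : x₁ ∈ L) (hvL : v ∉ L) (hbL : b ∈ L) (hcL : c ∈ L)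
    (hcross : ∀ x y : Fin n, x ∈ L → y ∉ L → y ≠ s → s(x, y) ≠ s(x₁, v) → w s(x, y) = 0)
    (IH : 0 ≤ (prodBernoulli (Function.update w s(x₁, v) 0)).real (openConn s x₁)ᶜ * ((prodBernoulli (Function.update w s(x₁, v) 0)).real ((openConn b x₁ \ openConn s x₁) ∩ openConn s c)
            + (prodBernoulli (Function.update w s(x₁, v) 0)).real ((openConn c x₁ \ openConn s x₁) ∩ openConn s b) + (prodBernoulli (Function.update w s(x₁, v) 0)).real ((openConn b x₁ ∩ openConn c x₁) \ openConn s x₁))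
        - (prodBernoulli (Function.update w s(x₁, v) 0)).real (openConn b x₁ \ openConn s x₁) * (prodBernoulli (Function.update w s(x₁, v) 0)).real (openConn c x₁ \ openConn s x₁)
        + (prodBernoulli (Function.update w s(x₁, v) 0)).real (openConn b x₁ \ openConn s x₁) * ((prodBernoulli (Function.update w s(x₁, v) 0)).real (openConn c x₁ \ openConn s x₁) + (prodBernoulli (Function.update w s(x₁, v) 0)).real ((openConn s x₁)ᶜ ∩ (openConn c x₁)ᶜ ∩ openConn s c)
            - (prodBernoulli (Function.update w s(x₁, v) 0)).real (openConn s x₁)ᶜ * (prodBernoulli (Function.update w s(x₁, v) 0)).real (openConn c x₁ ∪ openConn s c))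
        + (prodBernoulli (Function.update w s(x₁, v) 0)).real (openConn c x₁ \ openConn s x₁) * ((prodBernoulli (Function.update w s(x₁, v) 0)).real (openConn b x₁ \ openConn s x₁) + (prodBernoulli (Function.update w s(x₁, v) 0)).real ((openConn s x₁)ᶜ ∩ (openConn b x₁)ᶜ ∩ openConn s b)
            - (prodBernoulli (Function.update w s(x₁, v) 0)).real (openConn s x₁)ᶜ * (prodBernoulli (Function.update w s(x₁, v) 0)).real (openConn b x₁ ∪ openConn s b))) :
    0 ≤ (prodBernoulli w).real (openConn s v)ᶜ * ((prodBernoulli w).real ((openConn b v \ openConn s v) ∩ openConn s c)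
            + (prodBernoulli w).real ((openConn c v \ openConn s v) ∩ openConn s b) + (prodBernoulli w).real ((openConn b v ∩ openConn c v) \ openConn s v))
        - (prodBernoulli w).real (openConn b v \ openConn s v) * (prodBernoulli w).real (openConn c v \ openConn s v)
        + (prodBernoulli w).real (openConn b v \ openConn s v) * ((prodBernoulli w).real (openConn c v \ openConn s v) + (prodBernoulli w).real ((openConn s v)ᶜ ∩ (openConn c v)ᶜ ∩ openConn s c)
            - (prodBernoulli w).real (openConn s v)ᶜ * (prodBernoulli w).real (openConn c v ∪ openConn s c))
        + (prodBernoulli w).real (openConn c v \ openConn s v) * ((prodBernoulli w).real (openConn b v \ openConn s v) + (prodBernoulli w).real ((openConn s v)ᶜ ∩ (openConn b v)ᶜ ∩ openConn s b)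
            - (prodBernoulli w).real (openConn s v)ᶜ * (prodBernoulli w).real (openConn b v ∪ openConn s b)) := by
  -- names
  set e : Sym2 (Fin n) := s(x₁, v)
  set w0 := Function.update w e 0 with hw0
  set w1 := Function.update w e 1
  have hs1 : s ∈ insert s L := Set.mem_insert s L
  have hx1 : x₁ ∈ insert s L := Set.mem_insert_of_mem s hxL
  have hb1 : b ∈ insert s L := Set.mem_insert_of_mem s hbL
  have hc1 : c ∈ insert s L := Set.mem_insert_of_mem s hcL
  -- near events and the far event
  set S : Set (BondConfig (Fin n)) := openConnIn (insert s L) s x₁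
  set Bn : Set (BondConfig (Fin n)) := openConnIn (insert s L) s b
  set Cn : Set (BondConfig (Fin n)) := openConnIn (insert s L) s c
  set Fb : Set (BondConfig (Fin n)) := openConnIn (insert s L) b x₁
  set Fc : Set (BondConfig (Fin n)) := openConnIn (insert s L) c x₁
  set W' : Set (BondConfig (Fin n)) := openConnIn Lᶜ s v
  -- (0) the bridge hypothesis under `w0`, the almost-sure set, independence
  have hw0cross : ∀ x y : Fin n, x ∈ L → y ∉ L → y ≠ s → w0 s(x, y) = 0 := by
    intro x y hx hy hys
    by_cases hxy : s(x, y) = e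
    · rw [hxy, hw0, Function.update_self]
    · rw [hw0, Function.update_of_ne hxy]; exact hcross x y hx hy hys hxy
  set G : Set (BondConfig (Fin n)) := {ω | ∀ e', w0 e' = 0 → e' ∉ ω}
  have hG1 : (prodBernoulli w0).real G = 1 := real_sureClosed w0
  have hωG : ∀ ω ∈ G, ∀ x y : Fin n, x ∈ L → y ∉ L → y ≠ s → s(x, y) ∉ ω :=
    fun ω hω x y hx hy hys => hω _ (hw0cross x y hx hy hys)
  have hm : ∀ X : Set (BondConfig (Fin n)), MeasurableSet X := fun _ => MeasurableSet.of_discrete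
  have hdiff : ∀ {A B : Set (BondConfig (Fin n))} {K' : Set (Sym2 (Fin n))},
      DeterminedBy A K' → DeterminedBy B K' → DeterminedBy (A \ B) K' := by
    intro A B K' hA hB
    rw [determinedBy_iff] at hA hB ⊢
    intro ω ω' h
    rw [Set.mem_sdiff, Set.mem_sdiff, hA ω ω' h, hB ω ω' h]
  have hdn : ∀ x y : Fin n, DeterminedBy (openConnIn (insert s L) x y : Set (BondConfig (Fin n)))
      {z : Sym2 (Fin n) | ¬ z.IsDiag ∧ ∀ x ∈ z, x ∈ insert s L} := fun x y => IncStarCutVertex.determinedBy_openConnIn_offDiag _ x y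
  have hdW'c : DeterminedBy (Set.univ \ W') {z : Sym2 (Fin n) | ¬ z.IsDiag ∧ ∀ x ∈ z, x ∈ Lᶜ} :=
    hdiff (determinedBy_univ _) (IncStarCutVertex.determinedBy_openConnIn_offDiag _ s v)
  have indep : ∀ {A B : Set (BondConfig (Fin n))}, DeterminedBy A {z : Sym2 (Fin n) | ¬ z.IsDiag ∧ ∀ x ∈ z, x ∈ insert s L} →
      DeterminedBy B {z : Sym2 (Fin n) | ¬ z.IsDiag ∧ ∀ x ∈ z, x ∈ Lᶜ} →
      (prodBernoulli w0).real (A ∩ B) = (prodBernoulli w0).real A * (prodBernoulli w0).real B :=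
    fun hA hB => indep_blocks w0 L s hA hB
  -- (1) dictionary on the sure set
  have c_sv : ∀ ω ∈ G, (ω ∈ openConn s v ↔ ω ∈ W') := fun ω hω => by
    rw [bridge_conn_lr L hsL (hωG ω hω) hs1 hvL]
    exact ⟨fun h => h.2, fun h => ⟨⟨hs1, hs1, SimpleGraph.Reachable.refl _⟩, h⟩⟩
  have c_sb : ∀ ω ∈ G, (ω ∈ openConn s b ↔ ω ∈ Bn) := fun ω hω => bridge_conn_ll L hsL (hωG ω hω) hs1 hb1
  have c_sc : ∀ ω ∈ G, (ω ∈ openConn s c ↔ ω ∈ Cn) := fun ω hω => bridge_conn_ll L hsL (hωG ω hω) hs1 hc1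
  have c_bv : ∀ ω ∈ G, (ω ∈ openConn b v ↔ ω ∈ Bn ∧ ω ∈ W') := fun ω hω => by
    rw [bridge_conn_lr L hsL (hωG ω hω) hb1 hvL]
    exact ⟨fun h => ⟨openConnIn_symm' h.1, h.2⟩, fun h => ⟨openConnIn_symm' h.1, h.2⟩⟩
  have c_cv : ∀ ω ∈ G, (ω ∈ openConn c v ↔ ω ∈ Cn ∧ ω ∈ W') := fun ω hω => by
    rw [bridge_conn_lr L hsL (hωG ω hω) hc1 hvL]
    exact ⟨fun h => ⟨openConnIn_symm' h.1, h.2⟩, fun h => ⟨openConnIn_symm' h.1, h.2⟩⟩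
  have c_bx : ∀ ω ∈ G, (ω ∈ openConn b x₁ ↔ ω ∈ Fb) := fun ω hω => bridge_conn_ll L hsL (hωG ω hω) hb1 hx1
  have c_cx : ∀ ω ∈ G, (ω ∈ openConn c x₁ ↔ ω ∈ Fc) := fun ω hω => bridge_conn_ll L hsL (hωG ω hω) hc1 hx1
  have c_xb : ∀ ω ∈ G, (ω ∈ openConn x₁ b ↔ ω ∈ Fb) := fun ω hω => by
    rw [bridge_conn_ll L hsL (hωG ω hω) hx1 hb1]; exact ⟨fun h => openConnIn_symm' h, fun h => openConnIn_symm' h⟩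
  have c_xc : ∀ ω ∈ G, (ω ∈ openConn x₁ c ↔ ω ∈ Fc) := fun ω hω => by
    rw [bridge_conn_ll L hsL (hωG ω hω) hx1 hc1]; exact ⟨fun h => openConnIn_symm' h, fun h => openConnIn_symm' h⟩
  have c_sx : ∀ ω ∈ G, (ω ∈ openConn s x₁ ↔ ω ∈ S) := fun ω hω => bridge_conn_ll L hsL (hωG ω hω) hs1 hx1
  have c_xs : ∀ ω ∈ G, (ω ∈ openConn x₁ s ↔ ω ∈ S) := fun ω hω => by
    rw [bridge_conn_ll L hsL (hωG ω hω) hx1 hs1]; exact ⟨fun h => openConnIn_symm' h, fun h => openConnIn_symm' h⟩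
  -- (2) lifted events
  have l_sv : ∀ ω ∈ G, (insert e ω ∈ openConn s v ↔ ω ∈ W' ∨ ω ∈ S) := fun ω hω => by
    rw [bridge_lift_far L hsL hxL hvL hvL (hωG ω hω)]
    have hvv : ω ∈ openConnIn Lᶜ v v := ⟨hvL, hvL, SimpleGraph.Reachable.refl _⟩
    exact ⟨fun h => h.imp id fun h' => h'.1, fun h => h.imp id fun h' => ⟨h', hvv⟩⟩
  have l_sb : ∀ ω ∈ G, (insert e ω ∈ openConn s b ↔ ω ∈ Bn ∨ (ω ∈ W' ∧ ω ∈ Fb)) := fun ω hω => by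
    rw [bridge_lift_near L hsL hxL hvL hbL (hωG ω hω)]
    exact ⟨fun h => h.imp id fun h' => ⟨h'.1, openConnIn_symm' h'.2⟩, fun h => h.imp id fun h' => ⟨h'.1, openConnIn_symm' h'.2⟩⟩
  have l_sc : ∀ ω ∈ G, (insert e ω ∈ openConn s c ↔ ω ∈ Cn ∨ (ω ∈ W' ∧ ω ∈ Fc)) := fun ω hω => by
    rw [bridge_lift_near L hsL hxL hvL hcL (hωG ω hω)]
    exact ⟨fun h => h.imp id fun h' => ⟨h'.1, openConnIn_symm' h'.2⟩, fun h => h.imp id fun h' => ⟨h'.1, openConnIn_symm' h'.2⟩⟩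
  have l_bv : ∀ ω ∈ G, (insert e ω ∈ openConn b v ↔ (ω ∈ Bn ∧ ω ∈ W') ∨ ω ∈ Fb) := fun ω hω => by
    rw [insert_pair_mem_openConn_iff, c_bv ω hω, c_bx ω hω]
    have hvv : ω ∈ openConn v v := SimpleGraph.Reachable.refl _
    constructor
    · rintro (h | ⟨h1, -⟩)
      · exact Or.inl h
      · exact h1.symm
    · rintro (h | h)
      · exact Or.inl h
      · exact Or.inr ⟨Or.inl h, Or.inr hvv⟩
  have l_cv : ∀ ω ∈ G, (insert e ω ∈ openConn c v ↔ (ω ∈ Cn ∧ ω ∈ W') ∨ ω ∈ Fc) := fun ω hω => by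
    rw [insert_pair_mem_openConn_iff, c_cv ω hω, c_cx ω hω]
    have hvv : ω ∈ openConn v v := SimpleGraph.Reachable.refl _
    constructor
    · rintro (h | ⟨h1, -⟩)
      · exact Or.inl h
      · exact h1.symm
    · rintro (h | h)
      · exact Or.inl h
      · exact Or.inr ⟨Or.inl h, Or.inr hvv⟩
  -- (3) one-bond decomposition and the lift
  have ob : ∀ A : Set (BondConfig (Fin n)),
      (prodBernoulli w).real A = (1 - (w e : ℝ)) * (prodBernoulli w0).real A + (w e : ℝ) * (prodBernoulli w1).real A := by
    intro A
    have hA : DeterminedBy A (↑(Finset.univ : Finset (Sym2 (Fin n))) : Set (Sym2 (Fin n))) := by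
      rw [determinedBy_iff]
      intro ω ω' h
      rw [Finset.coe_univ, Set.inter_univ, Set.inter_univ] at h
      rw [h]
    exact prodBernoulli_real_oneBond hA w (Finset.mem_univ e)
  have lift : ∀ A : Set (BondConfig (Fin n)),
      (prodBernoulli w1).real A = (prodBernoulli w0).real ((fun ω : BondConfig (Fin n) => insert e ω) ⁻¹' A) :=
    fun A => tieLiftOne_real_one_eq w e A
  have zero_of_empty : ∀ {A : Set (BondConfig (Fin n))}, (∀ ω ∈ G, ω ∉ A) → (prodBernoulli w0).real A = 0 := by
    intro A hA
    have h : (prodBernoulli w0).real A = (prodBernoulli w0).real (∅ : Set (BondConfig (Fin n))) :=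
      real_congr_of_sure hG1 fun ω hω => ⟨fun h => (hA ω hω h).elim, fun h => (Set.notMem_empty _ h).elim⟩
    rw [h, measureReal_empty]
  -- (4) moments under `w0`
  have a0 : (prodBernoulli w0).real (openConn s v)ᶜ = (prodBernoulli w0).real (Set.univ \ W') :=
    real_congr_of_sure hG1 fun ω hω => by
      rw [Set.mem_compl_iff, c_sv ω hω, Set.mem_sdiff]; exact ⟨fun h => ⟨Set.mem_univ _, h⟩, fun h => h.2⟩
  have db0 : (prodBernoulli w0).real (openConn b v \ openConn s v) = 0 :=
    zero_of_empty fun ω hω h => by rw [Set.mem_sdiff, c_bv ω hω, c_sv ω hω] at h; exact h.2 h.1.2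
  have dc0 : (prodBernoulli w0).real (openConn c v \ openConn s v) = 0 :=
    zero_of_empty fun ω hω h => by rw [Set.mem_sdiff, c_cv ω hω, c_sv ω hω] at h; exact h.2 h.1.2
  have dbc0 : (prodBernoulli w0).real ((openConn b v ∩ openConn c v) \ openConn s v) = 0 :=
    zero_of_empty fun ω hω h => by
      rw [Set.mem_sdiff, Set.mem_inter_iff, c_bv ω hω, c_sv ω hω] at h; exact h.2 h.1.1.2
  have xb0 : (prodBernoulli w0).real ((openConn b v \ openConn s v) ∩ openConn s c) = 0 :=
    zero_of_empty fun ω hω h => by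
      rw [Set.mem_inter_iff, Set.mem_sdiff, c_bv ω hω, c_sv ω hω] at h; exact h.1.2 h.1.1.2
  have xc0 : (prodBernoulli w0).real ((openConn c v \ openConn s v) ∩ openConn s b) = 0 :=
    zero_of_empty fun ω hω h => by
      rw [Set.mem_inter_iff, Set.mem_sdiff, c_cv ω hω, c_sv ω hω] at h; exact h.1.2 h.1.1.2
  have hb0 : (prodBernoulli w0).real ((openConn s v)ᶜ ∩ (openConn b v)ᶜ ∩ openConn s b)
      = (prodBernoulli w0).real Bn * (prodBernoulli w0).real (Set.univ \ W') := by
    rw [← indep (hdn s b) hdW'c]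
    refine real_congr_of_sure hG1 fun ω hω => ?_
    simp only [Set.mem_inter_iff, Set.mem_compl_iff, Set.mem_sdiff, Set.mem_univ, true_and, c_sv ω hω, c_bv ω hω, c_sb ω hω]
    tauto
  have hc0 : (prodBernoulli w0).real ((openConn s v)ᶜ ∩ (openConn c v)ᶜ ∩ openConn s c)
      = (prodBernoulli w0).real Cn * (prodBernoulli w0).real (Set.univ \ W') := by
    rw [← indep (hdn s c) hdW'c]
    refine real_congr_of_sure hG1 fun ω hω => ?_
    simp only [Set.mem_inter_iff, Set.mem_compl_iff, Set.mem_sdiff, Set.mem_univ, true_and, c_sv ω hω, c_cv ω hω, c_sc ω hω]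
    tauto
  have zb0 : (prodBernoulli w0).real (openConn b v ∪ openConn s b) = (prodBernoulli w0).real Bn :=
    real_congr_of_sure hG1 fun ω hω => by
      rw [Set.mem_union, c_bv ω hω, c_sb ω hω]; exact ⟨fun h => h.elim (fun h' => h'.1) id, fun h => Or.inr h⟩
  have zc0 : (prodBernoulli w0).real (openConn c v ∪ openConn s c) = (prodBernoulli w0).real Cn :=
    real_congr_of_sure hG1 fun ω hω => by
      rw [Set.mem_union, c_cv ω hω, c_sc ω hω]; exact ⟨fun h => h.elim (fun h' => h'.1) id, fun h => Or.inr h⟩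
  -- (5) moments under `w1`
  have a1 : (prodBernoulli w1).real (openConn s v)ᶜ
      = (prodBernoulli w0).real (Set.univ \ S) * (prodBernoulli w0).real (Set.univ \ W') := by
    rw [lift, ← indep (hdiff (determinedBy_univ _) (hdn s x₁)) hdW'c]
    refine real_congr_of_sure hG1 fun ω hω => ?_
    simp only [Set.preimage_compl, Set.mem_compl_iff, Set.mem_preimage, l_sv ω hω, Set.mem_inter_iff, Set.mem_sdiff,
      Set.mem_univ, true_and]
    tauto
  have db1 : (prodBernoulli w1).real (openConn b v \ openConn s v)
      = (prodBernoulli w0).real (Fb \ S) * (prodBernoulli w0).real (Set.univ \ W') := by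
    rw [lift, ← indep (hdiff (hdn b x₁) (hdn s x₁)) hdW'c]
    refine real_congr_of_sure hG1 fun ω hω => ?_
    simp only [Set.preimage_sdiff, Set.mem_sdiff, Set.mem_preimage, l_bv ω hω, l_sv ω hω, Set.mem_inter_iff, Set.mem_univ,
      true_and]
    tauto
  have dc1 : (prodBernoulli w1).real (openConn c v \ openConn s v)
      = (prodBernoulli w0).real (Fc \ S) * (prodBernoulli w0).real (Set.univ \ W') := by
    rw [lift, ← indep (hdiff (hdn c x₁) (hdn s x₁)) hdW'c]
    refine real_congr_of_sure hG1 fun ω hω => ?_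
    simp only [Set.preimage_sdiff, Set.mem_sdiff, Set.mem_preimage, l_cv ω hω, l_sv ω hω, Set.mem_inter_iff, Set.mem_univ,
      true_and]
    tauto
  have dbc1 : (prodBernoulli w1).real ((openConn b v ∩ openConn c v) \ openConn s v)
      = (prodBernoulli w0).real ((Fb ∩ Fc) \ S) * (prodBernoulli w0).real (Set.univ \ W') := by
    rw [lift, ← indep (hdiff ((hdn b x₁).inter (hdn c x₁)) (hdn s x₁)) hdW'c]
    refine real_congr_of_sure hG1 fun ω hω => ?_
    simp only [Set.preimage_sdiff, Set.preimage_inter, Set.mem_sdiff, Set.mem_inter_iff, Set.mem_preimage, l_bv ω hω, l_cv ω hω,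
      l_sv ω hω, Set.mem_univ, true_and]
    tauto
  have xb1 : (prodBernoulli w1).real ((openConn b v \ openConn s v) ∩ openConn s c)
      = (prodBernoulli w0).real ((Fb \ S) ∩ Cn) * (prodBernoulli w0).real (Set.univ \ W') := by
    rw [lift, ← indep ((hdiff (hdn b x₁) (hdn s x₁)).inter (hdn s c)) hdW'c]
    refine real_congr_of_sure hG1 fun ω hω => ?_
    simp only [Set.preimage_sdiff, Set.preimage_inter, Set.mem_sdiff, Set.mem_inter_iff, Set.mem_preimage, l_bv ω hω, l_sc ω hω,
      l_sv ω hω, Set.mem_univ, true_and]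
    tauto
  have xc1 : (prodBernoulli w1).real ((openConn c v \ openConn s v) ∩ openConn s b)
      = (prodBernoulli w0).real ((Fc \ S) ∩ Bn) * (prodBernoulli w0).real (Set.univ \ W') := by
    rw [lift, ← indep ((hdiff (hdn c x₁) (hdn s x₁)).inter (hdn s b)) hdW'c]
    refine real_congr_of_sure hG1 fun ω hω => ?_
    simp only [Set.preimage_sdiff, Set.preimage_inter, Set.mem_sdiff, Set.mem_inter_iff, Set.mem_preimage, l_cv ω hω, l_sb ω hω,
      l_sv ω hω, Set.mem_univ, true_and]
    tauto
  have hb1' : (prodBernoulli w1).real ((openConn s v)ᶜ ∩ (openConn b v)ᶜ ∩ openConn s b)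
      = (prodBernoulli w0).real ((Bn \ S) \ Fb) * (prodBernoulli w0).real (Set.univ \ W') := by
    rw [lift, ← indep (hdiff (hdiff (hdn s b) (hdn s x₁)) (hdn b x₁)) hdW'c]
    refine real_congr_of_sure hG1 fun ω hω => ?_
    simp only [Set.preimage_inter, Set.preimage_compl, Set.mem_inter_iff, Set.mem_compl_iff, Set.mem_preimage,
      l_sv ω hω, l_bv ω hω, l_sb ω hω, Set.mem_sdiff, Set.mem_univ, true_and]
    tauto
  have hc1' : (prodBernoulli w1).real ((openConn s v)ᶜ ∩ (openConn c v)ᶜ ∩ openConn s c)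
      = (prodBernoulli w0).real ((Cn \ S) \ Fc) * (prodBernoulli w0).real (Set.univ \ W') := by
    rw [lift, ← indep (hdiff (hdiff (hdn s c) (hdn s x₁)) (hdn c x₁)) hdW'c]
    refine real_congr_of_sure hG1 fun ω hω => ?_
    simp only [Set.preimage_inter, Set.preimage_compl, Set.mem_inter_iff, Set.mem_compl_iff, Set.mem_preimage,
      l_sv ω hω, l_cv ω hω, l_sc ω hω, Set.mem_sdiff, Set.mem_univ, true_and]
    tauto
  have zb1 : (prodBernoulli w1).real (openConn b v ∪ openConn s b) = (prodBernoulli w0).real (Fb ∪ Bn) := by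
    rw [lift]
    refine real_congr_of_sure hG1 fun ω hω => ?_
    simp only [Set.preimage_union, Set.mem_union, Set.mem_preimage, l_bv ω hω, l_sb ω hω]
    tauto
  have zc1 : (prodBernoulli w1).real (openConn c v ∪ openConn s c) = (prodBernoulli w0).real (Fc ∪ Cn) := by
    rw [lift]
    refine real_congr_of_sure hG1 fun ω hω => ?_
    simp only [Set.preimage_union, Set.mem_union, Set.mem_preimage, l_cv ω hω, l_sc ω hω]
    tauto
  -- (6) the sub-instance quantities in block form
  have eA₁ : (prodBernoulli w0).real (openConn s x₁)ᶜ = (prodBernoulli w0).real (Set.univ \ S) :=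
    real_congr_of_sure hG1 fun ω hω => by
      rw [Set.mem_compl_iff, c_sx ω hω, Set.mem_sdiff]; exact ⟨fun h => ⟨Set.mem_univ _, h⟩, fun h => h.2⟩
  have eDb : (prodBernoulli w0).real (openConn b x₁ \ openConn s x₁) = (prodBernoulli w0).real (Fb \ S) :=
    real_congr_of_sure hG1 fun ω hω => by rw [Set.mem_sdiff, Set.mem_sdiff, c_bx ω hω, c_sx ω hω]
  have eDc : (prodBernoulli w0).real (openConn c x₁ \ openConn s x₁) = (prodBernoulli w0).real (Fc \ S) :=
    real_congr_of_sure hG1 fun ω hω => by rw [Set.mem_sdiff, Set.mem_sdiff, c_cx ω hω, c_sx ω hω]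
  have eDbc : (prodBernoulli w0).real ((openConn b x₁ ∩ openConn c x₁) \ openConn s x₁) = (prodBernoulli w0).real ((Fb ∩ Fc) \ S) :=
    real_congr_of_sure hG1 fun ω hω => by
      rw [Set.mem_sdiff, Set.mem_sdiff, Set.mem_inter_iff, Set.mem_inter_iff, c_bx ω hω, c_cx ω hω, c_sx ω hω]
  have eXb : (prodBernoulli w0).real ((openConn b x₁ \ openConn s x₁) ∩ openConn s c) = (prodBernoulli w0).real ((Fb \ S) ∩ Cn) :=
    real_congr_of_sure hG1 fun ω hω => by
      rw [Set.mem_inter_iff, Set.mem_inter_iff, Set.mem_sdiff, Set.mem_sdiff, c_bx ω hω, c_sx ω hω, c_sc ω hω]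
  have eXc : (prodBernoulli w0).real ((openConn c x₁ \ openConn s x₁) ∩ openConn s b) = (prodBernoulli w0).real ((Fc \ S) ∩ Bn) :=
    real_congr_of_sure hG1 fun ω hω => by
      rw [Set.mem_inter_iff, Set.mem_inter_iff, Set.mem_sdiff, Set.mem_sdiff, c_cx ω hω, c_sx ω hω, c_sb ω hω]
  have eHb : (prodBernoulli w0).real ((openConn s x₁)ᶜ ∩ (openConn b x₁)ᶜ ∩ openConn s b)
      = (prodBernoulli w0).real ((Bn \ S) \ Fb) :=
    real_congr_of_sure hG1 fun ω hω => by
      simp only [Set.mem_inter_iff, Set.mem_compl_iff, c_sx ω hω, c_bx ω hω, c_sb ω hω, Set.mem_sdiff]; tauto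
  have eHc : (prodBernoulli w0).real ((openConn s x₁)ᶜ ∩ (openConn c x₁)ᶜ ∩ openConn s c)
      = (prodBernoulli w0).real ((Cn \ S) \ Fc) :=
    real_congr_of_sure hG1 fun ω hω => by
      simp only [Set.mem_inter_iff, Set.mem_compl_iff, c_sx ω hω, c_cx ω hω, c_sc ω hω, Set.mem_sdiff]; tauto
  have eZb : (prodBernoulli w0).real (openConn b x₁ ∪ openConn s b) = (prodBernoulli w0).real (Fb ∪ Bn) :=
    real_congr_of_sure hG1 fun ω hω => by rw [Set.mem_union, Set.mem_union, c_bx ω hω, c_sb ω hω]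
  have eZc : (prodBernoulli w0).real (openConn c x₁ ∪ openConn s c) = (prodBernoulli w0).real (Fc ∪ Cn) :=
    real_congr_of_sure hG1 fun ω hω => by rw [Set.mem_union, Set.mem_union, c_cx ω hω, c_sc ω hω]
  -- `Z₁ = m₁ + D₁` for both targets
  have zsplit : ∀ {t : Fin n} (ht1 : t ∈ insert s L),
      (prodBernoulli w0).real (openConnIn (insert s L) t x₁ ∪ openConnIn (insert s L) s t)
        = (prodBernoulli w0).real (openConnIn (insert s L) s t)
          + (prodBernoulli w0).real (openConnIn (insert s L) t x₁ \ S) := by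
    intro t ht1
    rw [← measureReal_union ?_ (hm _)]
    · congr 1
      ext ω
      simp only [Set.mem_union, Set.mem_sdiff]
      constructor
      · rintro (hF | hT)
        · by_cases hT : ω ∈ openConnIn (insert s L) s t
          · exact Or.inl hT
          · exact Or.inr ⟨hF, fun hS => hT (PlanarDuality.openConnIn_trans hS (openConnIn_symm' hF))⟩
        · exact Or.inl hT
      · rintro (hT | ⟨hF, -⟩)
        · exact Or.inr hT
        · exact Or.inl hF
    · exact Set.disjoint_left.2 fun ω hT hFS => hFS.2 (PlanarDuality.openConnIn_trans hT hFS.1)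
  have zsb := zsplit hb1
  have zsc := zsplit hc1
  -- (PA) = van den Berg–Kahn at `x₁` under `w0`
  have PA : (prodBernoulli w0).real (Fb \ S) * (prodBernoulli w0).real (Fc \ S)
      ≤ (prodBernoulli w0).real ((Fb ∩ Fc) \ S) * (prodBernoulli w0).real (Set.univ \ S) := by
    have h := Literature.Probability.Percolation.BergKahn.bergKahn_thm_1_1 w0 x₁ b c s
    have e1 : (prodBernoulli w0).real (openConn x₁ b ∩ (openConn x₁ s)ᶜ) = (prodBernoulli w0).real (Fb \ S) :=
      real_congr_of_sure hG1 fun ω hω => by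
        rw [Set.mem_inter_iff, Set.mem_compl_iff, Set.mem_sdiff, c_xb ω hω, c_xs ω hω]
    have e2 : (prodBernoulli w0).real (openConn x₁ c ∩ (openConn x₁ s)ᶜ) = (prodBernoulli w0).real (Fc \ S) :=
      real_congr_of_sure hG1 fun ω hω => by
        rw [Set.mem_inter_iff, Set.mem_compl_iff, Set.mem_sdiff, c_xc ω hω, c_xs ω hω]
    have e3 : (prodBernoulli w0).real (openConn x₁ b ∩ openConn x₁ c ∩ (openConn x₁ s)ᶜ)
        = (prodBernoulli w0).real ((Fb ∩ Fc) \ S) :=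
      real_congr_of_sure hG1 fun ω hω => by
        rw [Set.mem_inter_iff, Set.mem_inter_iff, Set.mem_compl_iff, Set.mem_sdiff, Set.mem_inter_iff, c_xb ω hω, c_xc ω hω,
          c_xs ω hω]
    have e4 : (prodBernoulli w0).real (openConn x₁ s)ᶜ = (prodBernoulli w0).real (Set.univ \ S) :=
      real_congr_of_sure hG1 fun ω hω => by
        rw [Set.mem_compl_iff, c_xs ω hω, Set.mem_sdiff]; exact ⟨fun h => ⟨Set.mem_univ _, h⟩, fun h => h.2⟩
    rw [e1, e2, e3, e4] at h
    exact h
  -- sign facts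
  have hp0 : (0 : ℝ) ≤ w e := (w e).2.1
  have hp1 : (w e : ℝ) ≤ 1 := (w e).2.2
  have hA₁1 : (prodBernoulli w0).real (Set.univ \ S) ≤ 1 := measureReal_le_one
  -- (7) assemble
  have IH' := IH
  rw [eA₁, eDb, eDc, eDbc, eXb, eXc, eHb, eHc, eZb, eZc, zsb, zsc] at IH'
  rw [ob (openConn s v)ᶜ, ob (openConn b v \ openConn s v), ob (openConn c v \ openConn s v),
    ob ((openConn b v ∩ openConn c v) \ openConn s v), ob ((openConn b v \ openConn s v) ∩ openConn s c),
    ob ((openConn c v \ openConn s v) ∩ openConn s b), ob ((openConn s v)ᶜ ∩ (openConn b v)ᶜ ∩ openConn s b),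
    ob ((openConn s v)ᶜ ∩ (openConn c v)ᶜ ∩ openConn s c), ob (openConn b v ∪ openConn s b), ob (openConn c v ∪ openConn s c),
    a0, a1, db0, db1, dc0, dc1, dbc0, dbc1, xb0, xb1, xc0, xc1, hb0, hb1', hc0, hc1', zb0, zb1, zc0, zc1, zsb, zsc]
  have key := psi_sameBranch_real (w e) ((prodBernoulli w0).real (Set.univ \ W')) ((prodBernoulli w0).real (Set.univ \ S))
    ((prodBernoulli w0).real (Fb \ S)) ((prodBernoulli w0).real (Fc \ S)) ((prodBernoulli w0).real ((Fb ∩ Fc) \ S))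
    ((prodBernoulli w0).real ((Fb \ S) ∩ Cn)) ((prodBernoulli w0).real ((Fc \ S) ∩ Bn))
    ((prodBernoulli w0).real ((Bn \ S) \ Fb)) ((prodBernoulli w0).real ((Cn \ S) \ Fc))
    ((prodBernoulli w0).real Bn) ((prodBernoulli w0).real Cn)
    hp0 hp1 measureReal_nonneg hA₁1 measureReal_nonneg measureReal_nonneg measureReal_nonneg PA IH'
  linarith [key]

end IncStar

end Summit.CriticalPhenomena.PercolationContinuityZ3.Theorems
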